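import Literature.AlgebraicGeometry.Motives.UniversalHypersurfaceTotalSpaceOverProper
import Literature.AlgebraicGeometry.HodgeTheory.CyclicCoverFormNonsingular
import Literature.AlgebraicGeometry.HodgeTheory.UniversalHypersurfaceDiscriminant
import HarnessLib

/-!
# The surface `x₃^p = x₂^{p−2}x₀x₁ + x₀^p + x₁^p` has exactly one singular point, the node `[0:0:1:0]`

Family `hodge`, layer `Literature/AlgebraicGeometry/HodgeTheory`. The cyclic cover `x₃^p = f₁` of `ℙ²` branched along the one-nodal curve
`f₁ = x₂^{p−2}x₀x₁ + x₀^p + x₁^p` (Carlson–Toledo 1999 §6, (kdoublept)) is singular exactly over the node `[0:0:1]` of `f₁`, at `x₃ = 0`: the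
common zeros of the partials `∂₀F = −(x₂^{p−2}x₁ + p x₀^{p−1})`, `∂₁F = −(x₂^{p−2}x₀ + p x₁^{p−1})`, `∂₂F = −(p−2)x₂^{p−3}x₀x₁`, `∂₃F = p x₃^{p−1}`
(`p ≥ 3`) are the multiples of `e₂`. On the complex points of the universal hypersurface `𝒴(ℂ)` this says (via the regular-locus criterion
`Motives/UniversalHypersurfaceTotalSpaceOverCoordinates.mem_range_map_regularToTotalSpaceOver_iff`): a fibre-singular point with coefficient vector
that of `x₃^p − f₁` has homogeneous coordinates `[0:0:1:0]` — the input of the upper-semicontinuity / compact-support argument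
`Motives/UniversalHypersurfaceTotalSpaceOverProper.exists_open_nhds_singular_subset` for the lifted vector fields of the degeneration programme
(`HodgeTheory/CyclicCoverNodalMeridianLocalMonodromyBound`).

* `cyclicCoverForm_nodal_eq` — `F = X₃^p − (X₂^{p−2}X₀X₁ + X₀^p + X₁^p)` in `ℂ[x₀,…,x₃]`;
* `eval_pderiv_cyclicCoverForm_nodal` — the four partials evaluated at `z`;
* `eq_node_of_partials_eq_zero` — **their common zeros are the multiples of `e₂`**;
* `hypersurfacePoint_eq_node_of_singular` — **a fibre-singular point of `𝒴(ℂ)` over `b₀ = coeffs(x₃^p − f₁)` has homogeneous coordinates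
  `[0:0:1:0]`.**

Everything is proved; no definitions, no named facts.

## References

* [CarlsonToledo1999] J. A. Carlson, D. Toledo, Duke Math. J. 97 (1999), §6 (kdoublept).
* [Hartshorne1977] R. Hartshorne, Algebraic Geometry (1977), I Ex. 5.8 (Jacobian criterion).
-/

noncomputable section

open MvPolynomial Set Function
open scoped LinearAlgebra.Projectivization
open Literature.AlgebraicGeometry.Motives Literature.AlgebraicGeometry.Motives.UniversalHypersurface
open Literature.AlgebraicGeometry.HodgeTheory.UniversalHypersurface

namespace Literature.AlgebraicGeometry.HodgeTheory

variable (p : ℕ)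

/-- `F = x₃^p − f₁` written out in `ℂ[x₀, x₁, x₂, x₃]`. [cite: CarlsonToledo1999, §6 (kdoublept)] -/
theorem cyclicCoverForm_nodal_eq :
    cyclicCoverForm p (X 2 ^ (p - 2) * (X 0 * X 1) + X 0 ^ p + X 1 ^ p) =
      (X 3 ^ p - (X 2 ^ (p - 2) * (X 0 * X 1) + X 0 ^ p + X 1 ^ p) : MvPolynomial (Fin 4) ℂ) := by
  rw [cyclicCoverForm_def]
  simp only [map_add, map_mul, map_pow, rename_X]
  rfl

/-- **The partials of `F = x₃^p − (x₂^{p−2}x₀x₁ + x₀^p + x₁^p)` at `z`** (`p ≥ 3`):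
`(−(z₂^{p−2}z₁ + p z₀^{p−1}), −(z₂^{p−2}z₀ + p z₁^{p−1}), −(p−2) z₂^{p−3} z₀ z₁, p z₃^{p−1})`. [cite: CarlsonToledo1999, §6 (kdoublept)] -/
theorem eval_pderiv_cyclicCoverForm_nodal (hp : 3 ≤ p) (z : Fin 4 → ℂ) :
    eval z (pderiv 0 (cyclicCoverForm p (X 2 ^ (p - 2) * (X 0 * X 1) + X 0 ^ p + X 1 ^ p))) =
        -(z 2 ^ (p - 2) * z 1 + p * z 0 ^ (p - 1)) ∧
      eval z (pderiv 1 (cyclicCoverForm p (X 2 ^ (p - 2) * (X 0 * X 1) + X 0 ^ p + X 1 ^ p))) =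
        -(z 2 ^ (p - 2) * z 0 + p * z 1 ^ (p - 1)) ∧
      eval z (pderiv 2 (cyclicCoverForm p (X 2 ^ (p - 2) * (X 0 * X 1) + X 0 ^ p + X 1 ^ p))) =
        -((p - 2 : ℕ) * z 2 ^ (p - 3) * (z 0 * z 1)) ∧
      eval z (pderiv 3 (cyclicCoverForm p (X 2 ^ (p - 2) * (X 0 * X 1) + X 0 ^ p + X 1 ^ p))) = p * z 3 ^ (p - 1) := by
  obtain ⟨m, rfl⟩ : ∃ m, p = m + 3 := ⟨p - 3, by omega⟩
  have h1 : m + 3 - 2 = m + 1 := by omega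
  have h2 : m + 3 - 3 = m := by omega
  have h3 : m + 3 - 1 = m + 2 := by omega
  rw [cyclicCoverForm_nodal_eq, h1, h2, h3]
  refine ⟨?_, ?_, ?_, ?_⟩ <;>
  · simp only [map_sub, map_add, map_neg, Derivation.leibniz, pderiv_pow, pderiv_X_self, smul_eq_mul,
      pderiv_X_of_ne (show (0 : Fin 4) ≠ 1 by decide), pderiv_X_of_ne (show (0 : Fin 4) ≠ 2 by decide),
      pderiv_X_of_ne (show (0 : Fin 4) ≠ 3 by decide), pderiv_X_of_ne (show (1 : Fin 4) ≠ 0 by decide),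
      pderiv_X_of_ne (show (1 : Fin 4) ≠ 2 by decide), pderiv_X_of_ne (show (1 : Fin 4) ≠ 3 by decide),
      pderiv_X_of_ne (show (2 : Fin 4) ≠ 0 by decide), pderiv_X_of_ne (show (2 : Fin 4) ≠ 1 by decide),
      pderiv_X_of_ne (show (2 : Fin 4) ≠ 3 by decide), pderiv_X_of_ne (show (3 : Fin 4) ≠ 0 by decide),
      pderiv_X_of_ne (show (3 : Fin 4) ≠ 1 by decide), pderiv_X_of_ne (show (3 : Fin 4) ≠ 2 by decide),
      mul_one, mul_zero, add_zero, zero_add, eval_X, map_mul, map_pow, map_natCast, sub_zero, zero_sub,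
      show m + 1 - 1 = m by omega, show m + 3 - 1 = m + 2 by omega]
    try push_cast
    try ring

/-- **The common zeros of the partials are the multiples of `e₂`** (`p ≥ 3`): if all four partials of `F` vanish at `z` then
`z₀ = z₁ = z₃ = 0`. [cite: CarlsonToledo1999, §6 (kdoublept)] [cite: Hartshorne1977, I Ex. 5.8] -/
theorem eq_node_of_partials_eq_zero (hp : 3 ≤ p) {z : Fin 4 → ℂ}
    (h : ∀ j : Fin 4, eval z (pderiv j (cyclicCoverForm p (X 2 ^ (p - 2) * (X 0 * X 1) + X 0 ^ p + X 1 ^ p))) = 0) :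
    z 0 = 0 ∧ z 1 = 0 ∧ z 3 = 0 := by
  obtain ⟨e0, e1, e2, e3⟩ := eval_pderiv_cyclicCoverForm_nodal p hp z
  have hp0 : (p : ℂ) ≠ 0 := by exact_mod_cast (show p ≠ 0 by omega)
  have h0 := h 0; rw [e0, neg_eq_zero] at h0
  have h1 := h 1; rw [e1, neg_eq_zero] at h1
  have h2 := h 2; rw [e2, neg_eq_zero] at h2
  have h3 := h 3; rw [e3] at h3
  have hz3 : z 3 = 0 := by
    have := mul_eq_zero.mp h3
    rcases this with h | h
    · exact absurd h hp0
    · exact pow_eq_zero_iff (by omega) |>.mp h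
  -- `z₀ z₁ = 0` or `z₂ = 0`
  have hp2 : ((p - 2 : ℕ) : ℂ) ≠ 0 := by exact_mod_cast (show p - 2 ≠ 0 by omega)
  by_cases hz2 : z 2 = 0
  · -- then `p z₀^{p-1} = 0` and `p z₁^{p-1} = 0`
    rw [hz2, zero_pow (by omega), zero_mul, zero_add] at h0 h1
    have hz0 : z 0 = 0 := pow_eq_zero_iff (by omega) |>.mp ((mul_eq_zero.mp h0).resolve_left hp0)
    have hz1 : z 1 = 0 := pow_eq_zero_iff (by omega) |>.mp ((mul_eq_zero.mp h1).resolve_left hp0)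
    exact ⟨hz0, hz1, hz3⟩
  · have h01 : z 0 * z 1 = 0 := by
      rcases mul_eq_zero.mp h2 with h | h
      · rcases mul_eq_zero.mp h with h' | h'
        · exact absurd h' hp2
        · exact absurd h' (pow_ne_zero _ hz2)
      · exact h
    rcases mul_eq_zero.mp h01 with hz0 | hz1
    · -- `z₀ = 0` ⇒ from `h0`: `z₂^{p-2} z₁ = 0` ⇒ `z₁ = 0`
      rw [hz0, zero_pow (by omega), mul_zero, add_zero] at h0
      have hz1 : z 1 = 0 := (mul_eq_zero.mp h0).resolve_left (pow_ne_zero _ hz2)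
      exact ⟨hz0, hz1, hz3⟩
    · rw [hz1, zero_pow (by omega), mul_zero, add_zero] at h1
      have hz0 : z 0 = 0 := (mul_eq_zero.mp h1).resolve_left (pow_ne_zero _ hz2)
      exact ⟨hz0, hz1, hz3⟩

/-- **A fibre-singular point of `𝒴(ℂ)` over the coefficient vector of `x₃^p − f₁` has homogeneous coordinates `[0:0:1:0]`** (`p ≥ 3`).
[cite: CarlsonToledo1999, §6 (kdoublept)] [cite: Hartshorne1977, I Ex. 5.8] -/
theorem hypersurfacePoint_eq_node_of_singular (hp : 3 ≤ p) {P : ComplexPoints (totalSpaceOver ℂ 2 p)}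
    (hP : P ∉ Set.range (AlgPoints.map (regularToTotalSpaceOver ℂ 2 p) :
      ComplexPoints (regularTotal ℂ 2 p) → ComplexPoints (totalSpaceOver ℂ 2 p)))
    (hb : tCoeff ℂ 2 p P = coeffsOf 2 p (cyclicCoverForm p (X 2 ^ (p - 2) * (X 0 * X 1) + X 0 ^ p + X 1 ^ p))) :
    hypersurfacePoint (totalOverToProjectiveSpace ℂ 2 p) P =
      Projectivization.mk ℂ (Pi.single (2 : Fin 4) (1 : ℂ)) (by simp) := by
  set F : MvPolynomial (Fin 4) ℂ := cyclicCoverForm p (X 2 ^ (p - 2) * (X 0 * X 1) + X 0 ^ p + X 1 ^ p) with hF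
  have hf₁ : (X 2 ^ (p - 2) * (X 0 * X 1) + X 0 ^ p + X 1 ^ p : MvPolynomial (Fin 3) ℂ).IsHomogeneous p := by
    obtain ⟨m, rfl⟩ : ∃ m, p = m + 3 := ⟨p - 3, by omega⟩
    have h1 : (X 2 ^ (m + 3 - 2) * (X 0 * X 1) : MvPolynomial (Fin 3) ℂ).IsHomogeneous (m + 3) := by
      have := (isHomogeneous_X_pow (R := ℂ) (2 : Fin 3) (m + 3 - 2)).mul
        ((isHomogeneous_X ℂ (0 : Fin 3)).mul (isHomogeneous_X ℂ (1 : Fin 3)))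
      convert this using 1
      omega
    exact (h1.add (isHomogeneous_X_pow (0 : Fin 3) (m + 3))).add (isHomogeneous_X_pow (1 : Fin 3) (m + 3))
  have hFh : F.IsHomogeneous p := CyclicCoverFormNonsingular.isHomogeneous_cyclicCoverForm_of_isHomogeneous hf₁
  have htForm : tForm ℂ 2 p P = F := by
    rw [tForm_eq_formOfCoeffs, hb]
    exact formOfCoeffs_coeff F hFh
  -- all partials vanish at the homogeneous coordinates
  rw [mem_range_map_regularToTotalSpaceOver_iff, not_exists] at hP
  set z := (hypersurfacePoint (totalOverToProjectiveSpace ℂ 2 p) P).rep with hzdef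
  have hz0 : z ≠ 0 := (hypersurfacePoint (totalOverToProjectiveSpace ℂ 2 p) P).rep_nonzero
  have hmk : Projectivization.mk ℂ z hz0 = hypersurfacePoint (totalOverToProjectiveSpace ℂ 2 p) P := Projectivization.mk_rep _
  have hpart : ∀ j : Fin 4, eval z (pderiv j F) = 0 := by
    intro j
    have hj := hP j
    rw [not_not, htForm, ← hmk, Projectivization.mem_projZeroLocus_mk_iff (by
      rintro G rfl
      by_cases h0 : pderiv j F = 0
      · rw [h0]; exact MvPolynomial.isHomogeneous_zero _ _ _
      · rw [(hFh.pderiv (i := j)).totalDegree h0]; exact hFh.pderiv)] at hj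
    simpa using hj
  obtain ⟨h0, h1, h3⟩ := eq_node_of_partials_eq_zero p hp hpart
  have hz2 : z 2 ≠ 0 := by
    intro h2
    apply hz0
    funext k
    fin_cases k
    · exact h0
    · exact h1
    · exact h2
    · exact h3
  rw [← hmk, Projectivization.mk_eq_mk_iff]
  refine ⟨Units.mk0 (z 2) hz2, ?_⟩
  funext k
  fin_cases k
  · simp [h0]
  · simp [h1]
  · simp
  · simp [h3]

end Literature.AlgebraicGeometry.HodgeTheory

end
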